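import Mathlib.Analysis.Calculus.ContDiff.Basic
import Literature.Analysis.Calculus.LineIntegrationBootstrapIterated   -- (d1′) p846500: `forall_norm_le_of_uniform_loss_two_walls`
import HarnessLib

/-!
# Line-integration bootstrap for JETS: all Fréchet derivatives of a smooth function with a UNIFORM polynomial loss at two walls are bounded (Harish-Chandra ∕ Warner II §8.4.3)

Topic `Analysis/Calculus`; namespace `Literature.Analysis.Calculus.LineBootstrap`.  THEOREMS ONLY (no `def`, no instance, no notation, no axiom, no named fact, no `sorry`).
Cell `pub/hodgecm-mathlib`, ENGINE T1 (crux H413 = `stmt-HodgeConjecture-24833`); ROAD «A6-IV» (owner∕architect F0P3a-p05 (g15), DESIGN v2 93542b84b04a2b0a), brick **(d1″)** = the JET SOCKET of the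
generic engine (d1′) for (d2) «JET-BOUND BOOTSTRAP» and (f1); pen F0P3a-p02 (g14), 2026-09-01.

THE MATHEMATICS [WarnerHASSLG2, §8.4.3, proof of Thm. 8.4.3.1].  §1 A continuous multilinear map on `(ℝ^d)^n` is bounded by its values on coordinate tuples:
`‖A‖ ≤ Σ_{k : Fin n → Fin d} ‖A(e_{k₁},…,e_{kₙ})‖` (sup norm on `ℝ^d`).  §2 THE DERIVATIVE FAMILY of a function smooth on an open set `U`: `v_{(n,u)}(θ) = Dⁿφ(θ)[u]`, closed under the line
derivative along any `e`: `∂_s Dⁿφ(θ + s e)[u] = Dⁿ⁺¹φ(θ + s e)[e,u]`.  §3 = (d1′) `forall_norm_le_of_uniform_loss_two_walls` for this family: if on a region `T ⊆ U`, `T ⊆ {0 < β ≤ 1} ∩ {0 < β′ ≤ 1}`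
closed under both exit families (`β e = 1`, `β′ e′ = 1`, `β′ e ≥ 0`), EVERY `Dⁿφ(θ)[u]` is `O_{n,u}((β θ)^{−n₀}(β′ θ)^{−n₀′})` with ONE pair `(n₀, n₀′)`, then every `Dⁿφ(θ)[u]` is BOUNDED on `T`; §4 on `V = ℝ^d`
the same with OPERATOR norms in hypothesis and conclusion: `(∀ n, ‖Dⁿφ‖ ≤ C_n·β^{−n₀}β′^{−n₀′} on T) ⟹ (∀ n, ‖Dⁿφ‖ ≤ M_n on T)` — the shape ★ `ArchCentralLimitFormulaRankTwo.of_chamberJetBounds_local`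
consumes at `n = 4` (with `T = C_σ ∩ B(0,r)` suitably trimmed so that the exit segments stay inside).
HONEST LABEL: HC_CM is proved only modulo the printed citations until rung 0 closes; generic calculus, pays nothing by itself.

* [WarnerHASSLG2] G. Warner, *Harmonic Analysis on Semi-Simple Lie Groups II* (1972), §8.4.3, Thm. 8.4.3.1 (proof: induction on `r` over all `∂(D)φ`).
* [Rudin1976] W. Rudin, *Principles of Mathematical Analysis*, 3rd ed. (1976), Thm. 9.21 ∕ 5.19 (chain rule; vector mean value inequality).
-/

noncomputable section

open Set

open scoped ContDiff

namespace Literature.Analysis.Calculus.LineBootstrap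

variable {E : Type*} [NormedAddCommGroup E] [NormedSpace ℝ E]

/-! ### §1 A multilinear map on `(ℝ^d)^n` is bounded by its values on coordinate tuples -/

section Multilinear

/-- Coordinates expand a vector of `ℝ^d`: `x = Σ_i x_i • e_i` read coordinatewise inside an `n`-tuple. [cite: Rudin1976, Thm. 9.21] -/
theorem tuple_eq_sum_smul_single {d n : ℕ} (m : Fin n → Fin d → ℝ) :
    m = fun j => ∑ i : Fin d, m j i • (Pi.single i (1 : ℝ) : Fin d → ℝ) := by
  funext j
  ext l
  simp [Finset.sum_apply, Pi.single_apply]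

/-- **`‖A‖ ≤ Σ_k ‖A(e_{k₁},…,e_{kₙ})‖`** for a continuous `n`-linear map on `ℝ^d` (sup norm): the operator norm is controlled by the `dⁿ` values on coordinate tuples. [cite: Rudin1976, Thm. 9.21] -/
theorem opNorm_le_sum_norm_apply_single {d n : ℕ} (A : ContinuousMultilinearMap ℝ (fun _ : Fin n => Fin d → ℝ) E) :
    ‖A‖ ≤ ∑ k : Fin n → Fin d, ‖A (fun j => (Pi.single (k j) (1 : ℝ) : Fin d → ℝ))‖ := by
  refine ContinuousMultilinearMap.opNorm_le_bound (Finset.sum_nonneg fun _ _ => norm_nonneg _) fun m => ?_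
  have hexp : A m = ∑ k : Fin n → Fin d, (∏ j, m j (k j)) • A (fun j => (Pi.single (k j) (1 : ℝ) : Fin d → ℝ)) := by
    conv_lhs => rw [tuple_eq_sum_smul_single m]
    rw [ContinuousMultilinearMap.map_sum]
    exact Finset.sum_congr rfl fun k _ => by rw [ContinuousMultilinearMap.map_smul_univ]
  rw [hexp, Finset.sum_mul]
  refine (norm_sum_le _ _).trans (Finset.sum_le_sum fun k _ => ?_)
  rw [norm_smul, mul_comm]
  refine mul_le_mul_of_nonneg_left ?_ (norm_nonneg _)
  rw [norm_prod]
  exact Finset.prod_le_prod (fun _ _ => norm_nonneg _) fun j _ => norm_le_pi_norm (m j) (k j)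

/-- Pointwise-to-operator: bounds on all coordinate-tuple values give a bound on the operator norm. [cite: Rudin1976, Thm. 9.21] -/
theorem opNorm_le_of_forall_apply_single_le {d n : ℕ} (A : ContinuousMultilinearMap ℝ (fun _ : Fin n => Fin d → ℝ) E) (C : (Fin n → Fin d) → ℝ)
    (h : ∀ k : Fin n → Fin d, ‖A (fun j => (Pi.single (k j) (1 : ℝ) : Fin d → ℝ))‖ ≤ C k) : ‖A‖ ≤ ∑ k : Fin n → Fin d, C k :=
  (opNorm_le_sum_norm_apply_single A).trans (Finset.sum_le_sum fun k _ => h k)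

end Multilinear

/-! ### §2 The derivative family of a smooth function is closed under line derivatives -/

section Family

variable {V : Type*} [NormedAddCommGroup V] [NormedSpace ℝ V]

/-- On an open set where `φ` is smooth, every `Dⁿφ` is differentiable. [cite: Rudin1976, Thm. 9.21] -/
theorem differentiableAt_iteratedFDeriv_of_contDiffOn (φ : V → E) {U : Set V} (hU : IsOpen U) (hφ : ContDiffOn ℝ ∞ φ U) (n : ℕ) {x : V} (hx : x ∈ U) :
    DifferentiableAt ℝ (iteratedFDeriv ℝ n φ) x :=
  (hφ.contDiffAt (hU.mem_nhds hx)).differentiableAt_iteratedFDeriv (WithTop.coe_lt_coe.2 (ENat.coe_lt_top n))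

/-- **THE LINE DERIVATIVE OF `Dⁿφ(·)[u]` IS `Dⁿ⁺¹φ(·)[e,u]`**: `∂_s Dⁿφ(θ + s•e)[u] = Dⁿ⁺¹φ(θ + s•e)[e ∷ u]` wherever `Dⁿφ` is differentiable. [cite: Rudin1976, Thm. 9.21] -/
theorem hasDerivAt_iteratedFDeriv_apply_line (φ : V → E) {n : ℕ} (u : Fin n → V) (θ e : V) (s : ℝ) (hd : DifferentiableAt ℝ (iteratedFDeriv ℝ n φ) (θ + s • e)) :
    HasDerivAt (fun s : ℝ => iteratedFDeriv ℝ n φ (θ + s • e) u) (iteratedFDeriv ℝ (n + 1) φ (θ + s • e) (Fin.cons e u)) s := by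
  have hline : HasDerivAt (fun s : ℝ => θ + s • e) e s := by
    simpa using ((hasDerivAt_id s).smul_const e).const_add θ
  have hcomp : HasDerivAt (fun s : ℝ => iteratedFDeriv ℝ n φ (θ + s • e)) (fderiv ℝ (iteratedFDeriv ℝ n φ) (θ + s • e) e) s :=
    hd.hasFDerivAt.comp_hasDerivAt s hline
  have heval := ((ContinuousMultilinearMap.apply ℝ (fun _ : Fin n => V) E u).hasFDerivAt).comp_hasDerivAt s hcomp
  rw [iteratedFDeriv_succ_apply_left, Fin.cons_zero, Fin.tail_cons]
  exact heval

/-- The derivative family along exit segments inside an open set of smoothness: for `θ + s•e ∈ U`, `∂_s Dⁿφ(θ + s•e)[u] = Dⁿ⁺¹φ(θ + s•e)[e ∷ u]`. [cite: WarnerHASSLG2, §8.4.3] -/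
theorem hasDerivAt_iteratedFDeriv_apply_line_of_mem (φ : V → E) {U : Set V} (hU : IsOpen U) (hφ : ContDiffOn ℝ ∞ φ U) {n : ℕ} (u : Fin n → V) (θ e : V)
    (s : ℝ) (hs : θ + s • e ∈ U) :
    HasDerivAt (fun s : ℝ => iteratedFDeriv ℝ n φ (θ + s • e) u) (iteratedFDeriv ℝ (n + 1) φ (θ + s • e) (Fin.cons e u)) s :=
  hasDerivAt_iteratedFDeriv_apply_line φ u θ e s (differentiableAt_iteratedFDeriv_of_contDiffOn φ hU hφ n hs)

end Family

/-! ### §3 The jet bootstrap: uniform loss for all `Dⁿφ[u]` ⟹ all `Dⁿφ[u]` bounded -/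

section Jets

variable {V : Type*} [NormedAddCommGroup V] [NormedSpace ℝ V]

/-- **JET BOOTSTRAP, TWO WALLS, APPLIED FORM.**  `φ` smooth on an open `U ⊇ T`; `T ⊆ {0 < β ≤ 1} ∩ {0 < β′ ≤ 1}` closed under the exit segments of `e` (to `β = 1`) and of `e′` (to `β′ = 1`),
`β e = 1`, `β′ e′ = 1`, `β′ e ≥ 0`.  If with ONE pair `(n₀, n₀′)` every derivative value satisfies `‖Dⁿφ(θ)[u]‖ ≤ M_{n,u}·(β θ)^{−n₀}·(β′ θ)^{−n₀′}` on `T`, then every `Dⁿφ(θ)[u]` is bounded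
on `T`. [cite: WarnerHASSLG2, §8.4.3, Thm. 8.4.3.1 (proof)] -/
theorem forall_iteratedFDeriv_apply_bounded_of_uniform_loss_two_walls (φ : V → E) {U : Set V} (hU : IsOpen U) (hφ : ContDiffOn ℝ ∞ φ U)
    (β β' : V →ₗ[ℝ] ℝ) (e e' : V) (hβe : β e = 1) (hβ'e' : β' e' = 1) (hβ'e : 0 ≤ β' e) (T : Set V) (hTU : T ⊆ U)
    (hT : ∀ θ ∈ T, 0 < β θ ∧ β θ ≤ 1) (hT' : ∀ θ ∈ T, 0 < β' θ ∧ β' θ ≤ 1)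
    (hseg : ∀ θ ∈ T, ∀ s ∈ Icc (0 : ℝ) (1 - β θ), θ + s • e ∈ T) (hseg' : ∀ θ ∈ T, ∀ s ∈ Icc (0 : ℝ) (1 - β' θ), θ + s • e' ∈ T)
    (n₀ n₀' : ℕ) (h : ∀ (n : ℕ) (u : Fin n → V), ∃ M : ℝ, 0 ≤ M ∧ ∀ θ ∈ T, ‖iteratedFDeriv ℝ n φ θ u‖ ≤ M * ((β θ) ^ n₀)⁻¹ * ((β' θ) ^ n₀')⁻¹) :
    ∀ (n : ℕ) (u : Fin n → V), ∃ M : ℝ, 0 ≤ M ∧ ∀ θ ∈ T, ‖iteratedFDeriv ℝ n φ θ u‖ ≤ M := by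
  -- the family indexed by `(n, u)`
  have key := forall_norm_le_of_uniform_loss_two_walls (ι := Σ n : ℕ, (Fin n → V)) (fun i θ => iteratedFDeriv ℝ i.1 φ θ i.2)
    (fun i => ⟨i.1 + 1, Fin.cons e i.2⟩) (fun i => ⟨i.1 + 1, Fin.cons e' i.2⟩) β β' e e' hβe hβ'e' hβ'e T hT hT' hseg hseg'
    (fun i θ hθ s hs => hasDerivAt_iteratedFDeriv_apply_line_of_mem φ hU hφ i.2 θ e s (hTU (hseg θ hθ s hs)))
    (fun i θ hθ s hs => hasDerivAt_iteratedFDeriv_apply_line_of_mem φ hU hφ i.2 θ e' s (hTU (hseg' θ hθ s hs)))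
    n₀ n₀' (fun i => h i.1 i.2)
  exact fun n u => key ⟨n, u⟩

end Jets

/-! ### §4 On `ℝ^d`: operator norms in, operator norms out -/

section OperatorNorm

/-- **JET BOOTSTRAP, TWO WALLS, OPERATOR-NORM FORM on `ℝ^d`.**  `φ : ℝ^d → E` smooth on an open `U ⊇ T`, `T` as in the applied form.  If with ONE pair `(n₀, n₀′)`:
`∀ n, ∃ C, ∀ θ ∈ T, ‖Dⁿφ(θ)‖ ≤ C·(β θ)^{−n₀}·(β′ θ)^{−n₀′}`, then `∀ n, ∃ M, ∀ θ ∈ T, ‖Dⁿφ(θ)‖ ≤ M` (Harish-Chandra's «induction on r» conclusion: all derivatives of `φ_f` stay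
bounded up to the walls of the sector chamber). [cite: WarnerHASSLG2, §8.4.3, Thm. 8.4.3.1] -/
theorem forall_norm_iteratedFDeriv_bounded_of_uniform_loss_two_walls {d : ℕ} (φ : (Fin d → ℝ) → E) {U : Set (Fin d → ℝ)} (hU : IsOpen U)
    (hφ : ContDiffOn ℝ ∞ φ U) (β β' : (Fin d → ℝ) →ₗ[ℝ] ℝ) (e e' : Fin d → ℝ) (hβe : β e = 1) (hβ'e' : β' e' = 1) (hβ'e : 0 ≤ β' e)
    (T : Set (Fin d → ℝ)) (hTU : T ⊆ U) (hT : ∀ θ ∈ T, 0 < β θ ∧ β θ ≤ 1) (hT' : ∀ θ ∈ T, 0 < β' θ ∧ β' θ ≤ 1)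
    (hseg : ∀ θ ∈ T, ∀ s ∈ Icc (0 : ℝ) (1 - β θ), θ + s • e ∈ T) (hseg' : ∀ θ ∈ T, ∀ s ∈ Icc (0 : ℝ) (1 - β' θ), θ + s • e' ∈ T)
    (n₀ n₀' : ℕ) (h : ∀ n : ℕ, ∃ C : ℝ, 0 ≤ C ∧ ∀ θ ∈ T, ‖iteratedFDeriv ℝ n φ θ‖ ≤ C * ((β θ) ^ n₀)⁻¹ * ((β' θ) ^ n₀')⁻¹) :
    ∀ n : ℕ, ∃ M : ℝ, 0 ≤ M ∧ ∀ θ ∈ T, ‖iteratedFDeriv ℝ n φ θ‖ ≤ M := by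
  -- operator bound ⟹ applied bounds with the uniform loss
  have happ : ∀ (n : ℕ) (u : Fin n → Fin d → ℝ), ∃ M : ℝ, 0 ≤ M ∧ ∀ θ ∈ T,
      ‖iteratedFDeriv ℝ n φ θ u‖ ≤ M * ((β θ) ^ n₀)⁻¹ * ((β' θ) ^ n₀')⁻¹ := by
    intro n u
    obtain ⟨C, hC, hb⟩ := h n
    refine ⟨C * ∏ j, ‖u j‖, mul_nonneg hC (Finset.prod_nonneg fun _ _ => norm_nonneg _), fun θ hθ => ?_⟩
    have h1 := (iteratedFDeriv ℝ n φ θ).le_opNorm u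
    have hw : 0 ≤ ((β θ) ^ n₀)⁻¹ * ((β' θ) ^ n₀')⁻¹ :=
      mul_nonneg (inv_nonneg.2 (pow_nonneg (hT θ hθ).1.le _)) (inv_nonneg.2 (pow_nonneg (hT' θ hθ).1.le _))
    have h2 := mul_le_mul_of_nonneg_right (hb θ hθ) (Finset.prod_nonneg fun j (_ : j ∈ Finset.univ) => norm_nonneg (u j))
    calc ‖iteratedFDeriv ℝ n φ θ u‖ ≤ ‖iteratedFDeriv ℝ n φ θ‖ * ∏ j, ‖u j‖ := h1
      _ ≤ C * ((β θ) ^ n₀)⁻¹ * ((β' θ) ^ n₀')⁻¹ * ∏ j, ‖u j‖ := h2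
      _ = C * (∏ j, ‖u j‖) * ((β θ) ^ n₀)⁻¹ * ((β' θ) ^ n₀')⁻¹ := by ring
  have key := forall_iteratedFDeriv_apply_bounded_of_uniform_loss_two_walls φ hU hφ β β' e e' hβe hβ'e' hβ'e T hTU hT hT' hseg hseg' n₀ n₀' happ
  intro n
  -- applied bounds on coordinate tuples ⟹ operator bound
  choose M hM0 hM using fun k : Fin n → Fin d => key n (fun j => (Pi.single (k j) (1 : ℝ) : Fin d → ℝ))
  refine ⟨∑ k, M k, Finset.sum_nonneg fun k _ => hM0 k, fun θ hθ => ?_⟩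
  exact opNorm_le_of_forall_apply_single_le _ M fun k => hM k θ hθ

end OperatorNorm

end Literature.Analysis.Calculus.LineBootstrap

end
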